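import Summits.MatrixMultiplication.OmegaCensus.SmallFormats.MatMul22nLoadedPlaneStructure
import HarnessLib

/-!
# ω-census family (a): the SYLVESTER rank identity for «invertible minus a sum of rank-one terms» (any field)

Cell `pub-omega` (unit `pub-omega-tensor`, gen 40), topic `Summits/MatrixMultiplication/OmegaCensus` (sub-folder
`SmallFormats`). Framing (verbatim): lottery ticket; floor = certified bounds/negative ranges. HONEST FRAMING: linear algebra for the M1
blueprint (memo DEFLATION-g40 §9(4), M1-LEAN-BLUEPRINT F4). For square matrices `A : m × p`, `B : p × m` the kernels of `1 − AB` and `1 − BA`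
are isomorphic (`x ↦ Bx`, `y ↦ Ay`; `nonempty_kerEquiv`, stated as `Nonempty` so the file carries no definition), hence `rank(1 − AB) + |p| = rank(1 − BA) + |m|` (`SylvesterRank.rank_one_sub_mul_add`); with `T` invertible,
`rank(T(1 − AB)) = rank(1 − AB)`. Used with `A = [d_t T⁻¹g_t]`, `B = [w_t]ᵀ`: `rank(T − ∑ d_t g_t w_tᵀ) = |m| − |p| + rank(1 − QD)`, and a `q × q` submatrix of
`Q` on DISJOINT row/column index sets with non-zero determinant gives `rank(1 − QD) ≥ q` (`rank_ge_of_disjoint_minor`). Nothing here is a bound on `ω`.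
-/

namespace Summit.MatrixMultiplication.OmegaCensus.SmallFormats

open Finset Module Matrix

namespace SylvesterRank

variable {k : Type*} [Field k] {m p : Type*} [Fintype m] [Fintype p] [DecidableEq m] [DecidableEq p]

/-- The kernels of `1 − AB` and `1 − BA` are linearly isomorphic (`x ↦ Bx`, `y ↦ Ay`). -/
theorem nonempty_kerEquiv (A : Matrix m p k) (B : Matrix p m k) :
    Nonempty (LinearMap.ker (Matrix.mulVecLin (1 - A * B)) ≃ₗ[k] LinearMap.ker (Matrix.mulVecLin (1 - B * A))) :=
  ⟨{
    toFun := fun x => ⟨B.mulVec x.1, by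
      have hx := x.2
      rw [LinearMap.mem_ker, Matrix.mulVecLin_apply, Matrix.sub_mulVec, Matrix.one_mulVec, sub_eq_zero] at hx ⊢
      rw [← Matrix.mulVec_mulVec]
      congr 1
      rw [Matrix.mulVec_mulVec]; exact hx⟩
    invFun := fun y => ⟨A.mulVec y.1, by
      have hy := y.2
      rw [LinearMap.mem_ker, Matrix.mulVecLin_apply, Matrix.sub_mulVec, Matrix.one_mulVec, sub_eq_zero] at hy ⊢
      rw [← Matrix.mulVec_mulVec]
      congr 1
      rw [Matrix.mulVec_mulVec]; exact hy⟩
    map_add' := fun x y => by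
      apply Subtype.ext
      simp [Matrix.mulVec_add]
    map_smul' := fun c x => by
      apply Subtype.ext
      simp [Matrix.mulVec_smul]
    left_inv := fun x => by
      apply Subtype.ext
      have hx := x.2
      rw [LinearMap.mem_ker, Matrix.mulVecLin_apply, Matrix.sub_mulVec, Matrix.one_mulVec, sub_eq_zero] at hx
      simp only
      rw [Matrix.mulVec_mulVec, ← hx]
    right_inv := fun y => by
      apply Subtype.ext
      have hy := y.2
      rw [LinearMap.mem_ker, Matrix.mulVecLin_apply, Matrix.sub_mulVec, Matrix.one_mulVec, sub_eq_zero] at hy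
      simp only
      rw [Matrix.mulVec_mulVec, ← hy] }⟩

/-- **Sylvester**: `rank(1 − AB) + |p| = rank(1 − BA) + |m|`. -/
theorem rank_one_sub_mul_add (A : Matrix m p k) (B : Matrix p m k) :
    (1 - A * B).rank + Fintype.card p = (1 - B * A).rank + Fintype.card m := by
  have h1 := LinearMap.finrank_range_add_finrank_ker (Matrix.mulVecLin (1 - A * B))
  have h2 := LinearMap.finrank_range_add_finrank_ker (Matrix.mulVecLin (1 - B * A))
  rw [Module.finrank_fintype_fun_eq_card] at h1 h2
  have hk : finrank k (LinearMap.ker (Matrix.mulVecLin (1 - A * B))) = finrank k (LinearMap.ker (Matrix.mulVecLin (1 - B * A))) :=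
    LinearEquiv.finrank_eq (nonempty_kerEquiv A B).some
  rw [Matrix.rank, Matrix.rank]
  omega

/-- A square submatrix on DISJOINT row and column index sets of `1 − Q D` (with `D` diagonal) is minus the corresponding submatrix of `Q`; if its
determinant is non-zero (and `D`'s entries are non-zero) the columns of `1 − QD` indexed by the column set are linearly independent, so `rank(1 − QD) ≥ q`. -/
theorem rank_ge_of_disjoint_minor {q : ℕ} (Q : Matrix p p k) (d : p → k) (hd : ∀ j, d j ≠ 0) (r c : Fin q → p)
    (hdisj : ∀ i j, r i ≠ c j) (hdet : (Matrix.of fun i j => Q (r i) (c j)).det ≠ 0) :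
    q ≤ (1 - Q * Matrix.diagonal d).rank := by
  classical
  set M : Matrix p p k := 1 - Q * Matrix.diagonal d with hM
  -- the columns c j of M are linearly independent
  have hcols : LinearIndependent k (fun j : Fin q => Mᵀ (c j)) := by
    rw [Fintype.linearIndependent_iff]
    intro a ha j₀
    -- restrict the relation to the rows r i: ∑_j a j * M (r i) (c j) = 0, and M (r i) (c j) = - Q (r i) (c j) * d (c j)
    have hrow : ∀ i, ∑ j, a j * (-(Q (r i) (c j) * d (c j))) = 0 := by
      intro i
      have h := congrFun ha (r i)
      simp only [Finset.sum_apply, Pi.smul_apply, Matrix.transpose_apply, smul_eq_mul, Pi.zero_apply] at h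
      rw [← h]
      refine Finset.sum_congr rfl fun j _ => ?_
      rw [hM, Matrix.sub_apply, Matrix.mul_diagonal, Matrix.one_apply_ne (hdisj i j)]
      ring
    -- the vector (a j * d (c j)) is killed by the minor ⇒ zero; but we need a = 0: use the minor on (a j * d (c j))? d may vanish; instead use
    -- the transposed minor acting on a directly: ∑_j (Q (r i) (c j) * d (c j)) a j = 0 is a relation for the matrix (Q (r i)(c j) * d(c j)).
    -- We avoid d: hypothesis hdet is on Q itself, so require the relation ∑_j Q (r i) (c j) * (d (c j) * a j) = 0 and conclude d(c j) a j = 0.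
    have hrel : Matrix.mulVec (Matrix.of fun i j => Q (r i) (c j)) (fun j => d (c j) * a j) = 0 := by
      funext i
      rw [Matrix.mulVec, dotProduct, Pi.zero_apply]
      have h := hrow i
      rw [← neg_eq_zero, ← Finset.sum_neg_distrib] at h
      rw [← h]
      refine Finset.sum_congr rfl fun j _ => ?_
      simp only [Matrix.of_apply]; ring
    have hz := Matrix.eq_zero_of_mulVec_eq_zero hdet hrel
    have := congrFun hz j₀
    simp only [Pi.zero_apply, mul_eq_zero] at this
    exact this.resolve_left (hd (c j₀))
  -- q independent columns ⇒ rank ≥ q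
  have h1 : finrank k (Submodule.span k (Set.range fun j : Fin q => Mᵀ (c j))) = q := by
    rw [finrank_span_eq_card hcols, Fintype.card_fin]
  have h2 : Submodule.span k (Set.range fun j : Fin q => Mᵀ (c j)) ≤ Submodule.span k (Set.range Mᵀ) :=
    Submodule.span_mono (by rintro _ ⟨j, rfl⟩; exact ⟨c j, rfl⟩)
  rw [Matrix.rank_eq_finrank_span_cols, ← h1]
  exact Submodule.finrank_mono h2

/-- **Rank of «invertible minus a sum of rank-one terms».** For an invertible `T : m × m`, vectors `g_t, w_t` and non-zero scalars `d_t` (`t ∈ p`), put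
`Q s t := w_s ⬝ᵥ (T⁻¹ g_t)`. If some `q × q` submatrix of `Q` on DISJOINT row/column index sets has non-zero determinant, then
`|m| + q ≤ rank(T − ∑_t d_t g_t w_tᵀ) + |p|` — i.e. `rank ≥ (|m| − |p|) + q`. -/
theorem card_add_le_rank_sub_sum (T : Matrix m m k) (hT : IsUnit T.det) (g w : p → (m → k)) (d : p → k) (hd : ∀ t, d t ≠ 0) {q : ℕ}
    (r c : Fin q → p) (hdisj : ∀ i j, r i ≠ c j)
    (hdet : (Matrix.of fun i j => w (r i) ⬝ᵥ (T⁻¹.mulVec (g (c j)))).det ≠ 0) :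
    Fintype.card m + q ≤ (T - ∑ t, d t • Matrix.vecMulVec (g t) (w t)).rank + Fintype.card p := by
  classical
  set A : Matrix m p k := fun i t => d t * (T⁻¹.mulVec (g t)) i with hA
  set B : Matrix p m k := fun t j => w t j with hB
  have hM : T - ∑ t, d t • Matrix.vecMulVec (g t) (w t) = T * (1 - A * B) := by
    rw [Matrix.mul_sub, Matrix.mul_one, ← Matrix.mul_assoc]
    congr 1
    ext i j
    rw [Matrix.sum_apply, Matrix.mul_apply]
    simp only [Matrix.smul_apply, Matrix.vecMulVec_apply, smul_eq_mul, hB]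
    simp only [Matrix.mul_apply, hA]
    -- ∑_t d t * g t i * w t j  =  ∑_x (T * A) i x * w x j, (T * A) i t = d t * (T T⁻¹ g t) i = d t * g t i
    refine Finset.sum_congr rfl fun t _ => ?_
    have hTA : ∑ x, T i x * (d t * (T⁻¹.mulVec (g t)) x) = d t * g t i := by
      have h := congrFun (Matrix.mulVec_mulVec (g t) T T⁻¹) i
      rw [Matrix.mul_nonsing_inv T hT, Matrix.one_mulVec] at h
      rw [← h, Matrix.mulVec, dotProduct, Finset.mul_sum]
      exact Finset.sum_congr rfl fun x _ => by ring
    rw [hTA]; ring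
  have hBA : B * A = (Matrix.of fun s t => w s ⬝ᵥ (T⁻¹.mulVec (g t))) * Matrix.diagonal d := by
    ext s t
    rw [Matrix.mul_diagonal, Matrix.of_apply, Matrix.mul_apply, dotProduct, Finset.sum_mul]
    exact Finset.sum_congr rfl fun i _ => by simp only [hA, hB]; ring
  rw [hM, Matrix.rank_mul_eq_right_of_isUnit_det T _ hT]
  have hsyl := rank_one_sub_mul_add A B
  have hq := rank_ge_of_disjoint_minor (Matrix.of fun s t => w s ⬝ᵥ (T⁻¹.mulVec (g t))) d hd r c hdisj hdet
  rw [← hBA] at hq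
  omega

end SylvesterRank

end Summit.MatrixMultiplication.OmegaCensus.SmallFormats
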